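import Mathlib
import Summits.ValiantsHypothesis.ValiantsHypothesis.Theorems.KPlusLogSqLawWeakLiftingTowerGraftSkewBlockIdentityCrossingsAnyColumn
import Summits.ValiantsHypothesis.ValiantsHypothesis.Theorems.KPlusLogSqLawWeakLiftingTowerGraftSkewBlockSimpleRoots
import Summits.ValiantsHypothesis.ValiantsHypothesis.Theorems.LacunarySymmetroidMatrixDescartesKThreeColumnLawHolds
import Summits.ValiantsHypothesis.ValiantsHypothesis.Theorems.LacunarySymmetroidMatrixDescartesStubDescartesCeiling

/-!
# Tower graft line — Θ(m²) IDENTITY-GRAFT PHANTOMS AT EVERY EVEN SIZE, FROM ROOT COUNTING ALONE (S4's object; the LOCATED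
# «o(ζ₊) = o(m²)» row of the NO-GO ledger goes KERNEL)

Calibration file for the line `Cruxes/WeakLifting/Lines/tower_graft.lean` (crux `WeakLifting` = stmt-ValiantsHypothesis-19561), object of S4
`stub_graftLawId`.  NO stub is claimed.

* (imported) `…IdentityCrossingsAnyColumn.skewBlock_identity_crossings'_rescaled` — p702623's mechanism with the rank condition
  «SOME column survives at each root» and no normalisation of the points.
* `skewBlock_identityGraft_of_sharp` — **ROOT COUNTING SUFFICES**: if the square block pencil `B(X) = Σ X^{dₗ}Bₗ` has `det B ≠ 0` with as many
  distinct positive roots as its monomial count allows (`#supp(det B) ≤ Z₊(det B) + 1`, DESCARTES-SHARP), then for the rescaled blocks and every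
  large far exponent some `η > 0` gives `Z₊(det G_η) = 0` and `Z₊(det(G_η + X^D·1)) ≥ 2·Z₊(det B)`.  The certificate points are manufactured
  from the sorted root set (`Finset.orderEmbOfFin`; `τ` = midpoints), and the rank condition at each root comes from p-SimpleRoots
  `exists_gram_det_ne_zero_of_sharp` (sharp ⇒ simple ⇒ `adj ≠ 0` ⇒ a column-deleted Gram determinant survives).
* `skewBlock_identityGraft_quadratic (q)` — **fed with the tree's DESCARTES-SHARP SYMMETRIC (k,3) FAMILY** (`…KThreeColumnLawHolds.not_posRootLawAt_three`:
  `ζ_sym(k,3) = C(k+2,2) − 1`, k = q+1; monomial ceiling `…StubDescartesCeiling.card_support_det_pencil_le`): for every `q` there are a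
  three-letter support `d`, SYMMETRIC blocks `B` of size `q+1`, a far exponent `D` and `η > 0` with `Z₊(det G_η) = 0` and
  `Z₊(det(G_η + X^D·1)) ≥ 2·(C(q+3,2) − 1) = (q+1)(q+4) = m²/4 + 3m/2` (`m = 2(q+1)` the size of `G_η`; `two_mul_choose_sub_one`).

READING (NO-GO ledger, kill-shape #38⁺): the row «any additive term `g(m) = o(ζ₊(m;d))`, in particular `o(m²)`, for an instance-level law
`Z₊(graft) ≤ c·(events) + g`» was LOCATED (memo `Lines/tower_graft-S5.md` §11.1 (L3): IVT-located roots of the sharp family could not be fed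
to p689545); for S4's object it is now KERNEL at every even `m`, with NO event of either kind (p688917, p703904).  Still inside the class budget
(`B ≥ ζ₊ ≥ C(m+2,2) − 1 > m²/4 + 3m/2`): ZERO crux credit, S4 at `C = 1` pays.  The support `d` is the sharp family's (existential here;
the family lives on `(0,1,D)`); the corner graft (S4b) is NOT covered (its column `j` is pinned to the corner).
HONEST FRAMING: nothing on S4/S4b/S5/S5ᴸ, TowerB, `WeakLifting`, Conjecture B, `MatrixDescartes` (18050) or `VP ≠ VNP`.  Def-free.
Seat: prover val-sym-lift-p2 g20, `--supports stmt-ValiantsHypothesis-19561`.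
-/

-- `Summit.ValiantsHypothesis.ValiantsHypothesis.…` repeats a component by the D-0017 layout
-- (single-conjunct summit), which the `dupNamespace` linter flags; the name is mandated.
set_option linter.dupNamespace false

namespace Summit.ValiantsHypothesis.ValiantsHypothesis.Theorems.KPlusLogSqLaw.TowerGraft

open Polynomial Matrix
open scoped BigOperators Polynomial

section IdentityGraftSharp

/-- the pencil matrix evaluated at a point. [folklore] -/
theorem lacunaryPencil_map_eval {K : ℕ} {n : Type*} [Fintype n] [DecidableEq n] (d : Fin K → ℕ) (B : Fin K → Matrix n n ℝ) (t : ℝ) :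
    (∑ l, (X : ℝ[X]) ^ d l • (B l).map C).map (eval t) = ∑ l, t ^ d l • B l := by
  ext i j
  simp [Matrix.map_apply, Matrix.sum_apply, Matrix.smul_apply, eval_finsetSum]
  exact Finset.sum_congr rfl fun x _ => mul_comm _ _

/-- **ROOT COUNTING SUFFICES**: a square block pencil whose determinant is Descartes-sharp (`det B ≠ 0`, `#supp(det B) ≤ Z₊(det B) + 1`) gives,
after rescaling and for every large far exponent, identity-graft phantoms `Z₊(det(G_η + X^D·1)) ≥ 2·Z₊(det B)` with `Z₊(det G_η) = 0`. [this work] -/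
theorem skewBlock_identityGraft_of_sharp {q K : ℕ} (d : Fin K → ℕ) (l₀ : Fin K) (B : Fin K → Matrix (Fin (q + 1)) (Fin (q + 1)) ℝ)
    (hdet : (∑ l, (X : ℝ[X]) ^ d l • (B l).map C).det ≠ 0)
    (hsharp : (∑ l, (X : ℝ[X]) ^ d l • (B l).map C).det.support.card ≤
      ((∑ l, (X : ℝ[X]) ^ d l • (B l).map C).det.roots.toFinset.filter (fun t => 0 < t)).card + 1) :
    ∃ Λ : ℝ, 0 < Λ ∧ ∃ D₀ : ℕ, ∀ D : ℕ, D₀ ≤ D → ∃ η : ℝ, 0 < η ∧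
      ((∑ l, (X : ℝ[X]) ^ d l • (Matrix.fromBlocks (if l = l₀ then η • (1 : Matrix (Fin (q + 1)) (Fin (q + 1)) ℝ) else 0)
        (Λ ^ d l • B l) (Λ ^ d l • B l)ᵀ
        (if l = l₀ then -(η • (1 : Matrix (Fin (q + 1)) (Fin (q + 1)) ℝ)) else 0)).map C).det.roots.toFinset.filter
        (fun t => 0 < t)).card = 0 ∧
      2 * ((∑ l, (X : ℝ[X]) ^ d l • (B l).map C).det.roots.toFinset.filter (fun t => 0 < t)).card ≤
        (((∑ l, (X : ℝ[X]) ^ d l • (Matrix.fromBlocks (if l = l₀ then η • (1 : Matrix (Fin (q + 1)) (Fin (q + 1)) ℝ) else 0)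
          (Λ ^ d l • B l) (Λ ^ d l • B l)ᵀ
          (if l = l₀ then -(η • (1 : Matrix (Fin (q + 1)) (Fin (q + 1)) ℝ)) else 0)).map C) +
        (X : ℝ[X]) ^ D • (1 : Matrix (Fin (q + 1) ⊕ Fin (q + 1)) (Fin (q + 1) ⊕ Fin (q + 1)) ℝ[X])).det.roots.toFinset.filter
        (fun t => 0 < t)).card := by
  classical
  set M : Matrix (Fin (q + 1)) (Fin (q + 1)) ℝ[X] := ∑ l, (X : ℝ[X]) ^ d l • (B l).map C with hM
  set f : ℝ[X] := M.det with hf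
  set R : Finset ℝ := f.roots.toFinset.filter (fun t => 0 < t) with hR
  set N : ℕ := R.card with hN
  have hmemR : ∀ x : ℝ, x ∈ R ↔ f.eval x = 0 ∧ 0 < x := fun x => by
    simp only [hR, Finset.mem_filter, Multiset.mem_toFinset, Polynomial.mem_roots hdet, Polynomial.IsRoot.def]
  have hfeval : ∀ t : ℝ, f.eval t = (∑ l, t ^ d l • B l).det := fun t => by rw [hf, hM, eval_det_pencil_of_fintype]
  -- the sorted positive roots, extended to a strictly increasing sequence on `ℕ`
  set e := R.orderEmbOfFin hN.symm with he
  set M₀ : ℝ := ∑ x ∈ R, x with hM₀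
  have hRpos : ∀ x ∈ R, 0 < x := fun x hx => ((hmemR x).mp hx).2
  have hM₀ge : ∀ x ∈ R, x ≤ M₀ := fun x hx =>
    Finset.single_le_sum (f := fun x => x) (fun y hy => (hRpos y hy).le) hx
  have hM₀nn : 0 ≤ M₀ := Finset.sum_nonneg fun y hy => (hRpos y hy).le
  set ρ : ℕ → ℝ := fun i => if h : i < N then e ⟨i, h⟩ else M₀ + ((i + 1 - N : ℕ) : ℝ) with hρ
  have hρe : ∀ (i : ℕ) (h : i < N), ρ i = e ⟨i, h⟩ := fun i h => by simp only [hρ, dif_pos h]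
  have hρmem : ∀ (i : ℕ), i < N → ρ i ∈ R := fun i h => by rw [hρe i h]; exact Finset.orderEmbOfFin_mem _ _ _
  have hρstep : ∀ i, ρ i < ρ (i + 1) := by
    intro i
    by_cases h1 : i + 1 < N
    · rw [hρe i (by omega), hρe (i + 1) h1]
      exact e.strictMono (Fin.mk_lt_mk.mpr (Nat.lt_succ_self i))
    · by_cases h2 : i < N
      · rw [hρe i h2]
        simp only [hρ, dif_neg h1]
        have : (i + 1 + 1 - N : ℕ) = 1 := by omega
        rw [this, Nat.cast_one]
        linarith [hM₀ge _ (Finset.orderEmbOfFin_mem R hN.symm ⟨i, h2⟩)]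
      · simp only [hρ, dif_neg h1, dif_neg h2]
        have : ((i + 1 + 1 - N : ℕ) : ℝ) = ((i + 1 - N : ℕ) : ℝ) + 1 := by
          rw [show (i + 1 + 1 - N : ℕ) = (i + 1 - N) + 1 by omega]; push_cast; ring
        rw [this]; linarith
  have hρmono : StrictMono ρ := strictMono_nat_of_lt_succ hρstep
  have hρ0 : 0 < ρ 0 := by
    by_cases h : 0 < N
    · exact hRpos _ (hρmem 0 h)
    · simp only [hρ, dif_neg h]
      have : (0 + 1 - N : ℕ) = 1 := by omega
      rw [this, Nat.cast_one]; linarith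
  have hρpos : ∀ i, 0 < ρ i := fun i => lt_of_lt_of_le hρ0 (hρmono.monotone (Nat.zero_le i))
  set τ : ℕ → ℝ := fun i => if i = 0 then ρ 0 / 2 else (ρ (i - 1) + ρ i) / 2 with hτ
  have hτ0 : τ 0 = ρ 0 / 2 := by simp [hτ]
  have hτS : ∀ i, τ (i + 1) = (ρ i + ρ (i + 1)) / 2 := fun i => by simp [hτ]
  have hτρ : ∀ i, τ i < ρ i := by
    intro i
    rcases i with _ | i
    · rw [hτ0]; linarith [hρ0]
    · rw [hτS]; linarith [hρstep i]
  have hρτ : ∀ i, ρ i < τ (i + 1) := fun i => by rw [hτS]; linarith [hρstep i]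
  have hτpos : ∀ i, 0 < τ i := by
    intro i
    rcases i with _ | i
    · rw [hτ0]; linarith [hρ0]
    · rw [hτS]; linarith [hρpos i, hρpos (i + 1)]
  -- `τ i` is never a root: it sits strictly between consecutive sorted roots (or below the first / above the last)
  have hτB : ∀ i, i ≤ N → (∑ l, τ i ^ d l • B l).det ≠ 0 := by
    intro i hi h0
    have hmem : τ i ∈ R := (hmemR _).mpr ⟨by rw [hfeval]; exact h0, hτpos i⟩
    obtain ⟨j, hj⟩ : ∃ j : Fin N, e j = τ i := by
      have : τ i ∈ Set.range e := by rw [he, Finset.range_orderEmbOfFin]; exact hmem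
      exact this
    rcases i with _ | i
    · -- below the first root
      have h1 : e ⟨0, j.pos⟩ ≤ e j := e.monotone (Fin.mk_le_mk.mpr (Nat.zero_le _))
      rw [hj, ← hρe 0 j.pos] at h1
      linarith [hτρ 0]
    · have hlo : ρ i < e j := by rw [hj]; exact hρτ i
      have hhi : e j < ρ (i + 1) := by rw [hj]; exact hτρ (i + 1)
      rw [hρe i (by omega)] at hlo
      have hij : (⟨i, by omega⟩ : Fin N) < j := e.lt_iff_lt.mp hlo
      by_cases h2 : i + 1 < N
      · rw [hρe (i + 1) h2] at hhi
        have hji : j < ⟨i + 1, h2⟩ := e.lt_iff_lt.mp hhi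
        rw [Fin.lt_def] at hij hji
        simp only at hij hji
        omega
      · have := j.isLt
        rw [Fin.lt_def] at hij
        simp only at hij
        omega
  have hρB : ∀ i, i < N → (∑ l, ρ i ^ d l • B l).det = 0 := fun i hi => by
    rw [← hfeval]; exact ((hmemR _).mp (hρmem i hi)).1
  have hρB'' : ∀ i, i < N → ∃ j : Fin (q + 1), (((∑ l, ρ i ^ d l • B l).submatrix id j.succAbove)ᵀ *
      ((∑ l, ρ i ^ d l • B l).submatrix id j.succAbove)).det ≠ 0 := by
    intro i hi
    have h := exists_gram_det_ne_zero_of_sharp M hdet hsharp (hρpos i) (by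
      rw [Polynomial.IsRoot.def, ← hf]; exact ((hmemR _).mp (hρmem i hi)).1)
    rwa [hM, lacunaryPencil_map_eval] at h
  obtain ⟨D₀, hD₀⟩ := skewBlock_identity_crossings'_rescaled d l₀ B N τ ρ hτρ hρτ hτpos hτB hρB hρB''
  exact ⟨τ N + 1, by linarith [hτpos N], D₀, fun D hD => hD₀ D hD⟩

/-- `(q+1)(q+4) + 2 = 2·C(q+3, 2)`. -/
theorem two_mul_choose_sub_one (q : ℕ) : 2 * (Nat.choose (q + 3) 2 - 1) = (q + 1) * (q + 4) := by
  have h : 2 * Nat.choose (q + 3) 2 = (q + 1) * (q + 4) + 2 := by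
    induction q with
    | zero => decide
    | succ n ih =>
      have e : Nat.choose (n + 1 + 3) 2 = Nat.choose (n + 3) 2 + (n + 3) := by
        rw [show n + 1 + 3 = (n + 3) + 1 by ring, Nat.choose_succ_succ, Nat.choose_one_right, add_comm]
      rw [e, mul_add, ih]
      ring
  omega

open Summit.ValiantsHypothesis.ValiantsHypothesis.Theorems.MatrixDescartes.Negative (PosRootLawAt) in
/-- **Θ(m²) IDENTITY-GRAFT PHANTOMS AT EVERY EVEN SIZE** (S4's object; calibration): for every `q` there are a three-letter support `d`,
SYMMETRIC blocks `B` of size `q+1`, a far exponent `D` and `η > 0` such that the symmetric skew-block pencil `G_η` of size `m = 2(q+1)` has NO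
positive root of `det G_η` while `det(G_η + X^D·1)` has at least `(q+1)(q+4) = m²/4 + 3m/2` distinct positive roots.  Data: the tree's
Descartes-sharp symmetric `(q+1, 3)` family (`not_posRootLawAt_three`), through `skewBlock_identityGraft_of_sharp`. [this work] -/
theorem skewBlock_identityGraft_quadratic (q : ℕ) :
    ∃ (d : Fin 3 → ℕ) (B : Fin 3 → Matrix (Fin (q + 1)) (Fin (q + 1)) ℝ) (D : ℕ) (η : ℝ), 0 < η ∧ (∀ l, (B l).IsSymm) ∧
      ((∑ l, (X : ℝ[X]) ^ d l • (Matrix.fromBlocks (if l = 0 then η • (1 : Matrix (Fin (q + 1)) (Fin (q + 1)) ℝ) else 0)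
        (B l) (B l)ᵀ (if l = 0 then -(η • (1 : Matrix (Fin (q + 1)) (Fin (q + 1)) ℝ)) else 0)).map C).det.roots.toFinset.filter
        (fun t => 0 < t)).card = 0 ∧
      (q + 1) * (q + 4) ≤ ((((∑ l, (X : ℝ[X]) ^ d l • (Matrix.fromBlocks (if l = 0 then η • (1 : Matrix (Fin (q + 1)) (Fin (q + 1)) ℝ) else 0)
          (B l) (B l)ᵀ (if l = 0 then -(η • (1 : Matrix (Fin (q + 1)) (Fin (q + 1)) ℝ)) else 0)).map C) +
        (X : ℝ[X]) ^ D • (1 : Matrix (Fin (q + 1) ⊕ Fin (q + 1)) (Fin (q + 1) ⊕ Fin (q + 1)) ℝ[X])).det).roots.toFinset.filter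
        (fun t => 0 < t)).card := by
  classical
  have hsharpFam := LacunarySymmetroidMatrixDescartes.Census.LagrangeTower.not_posRootLawAt_three (q + 1) (by omega)
  simp only [PosRootLawAt, not_forall, not_le, exists_prop] at hsharpFam
  obtain ⟨d, S, hS, hcard⟩ := hsharpFam
  have hch : Nat.choose (q + 1 + 2) 2 = Nat.choose (q + 3) 2 := by rw [show q + 1 + 2 = q + 3 by ring]
  rw [hch] at hcard
  have hC1 : 1 ≤ Nat.choose (q + 3) 2 := Nat.choose_pos (by omega)
  have hdet : (∑ l, (X : ℝ[X]) ^ d l • (S l).map C).det ≠ 0 := by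
    intro h0
    rw [h0, Polynomial.roots_zero, Multiset.toFinset_zero, Finset.filter_empty, Finset.card_empty] at hcard
    have h2 : Nat.choose (0 + 3) 2 ≤ Nat.choose (q + 3) 2 := Nat.choose_le_choose 2 (by omega)
    have h3 : Nat.choose (0 + 3) 2 = 3 := by decide
    omega
  have hsupp := LacunarySymmetroidMatrixDescartes.StubDescartesCeiling.card_support_det_pencil_le d S
  have hch2 : Nat.choose (q + 1 + 3 - 1) (q + 1) = Nat.choose (q + 3) 2 := by
    rw [show q + 1 + 3 - 1 = q + 3 by omega, show q + 3 = (q + 1) + 2 by ring, Nat.choose_symm_add]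
  rw [hch2] at hsupp
  have hsharp : (∑ l, (X : ℝ[X]) ^ d l • (S l).map C).det.support.card ≤
      ((∑ l, (X : ℝ[X]) ^ d l • (S l).map C).det.roots.toFinset.filter (fun t => 0 < t)).card + 1 := by omega
  obtain ⟨Λ, hΛ, D₀, hD₀⟩ := skewBlock_identityGraft_of_sharp d 0 S hdet hsharp
  obtain ⟨η, hη, h1, h2⟩ := hD₀ D₀ le_rfl
  refine ⟨d, fun l => Λ ^ d l • S l, D₀, η, hη, fun l => (hS l).smul _, h1, le_trans ?_ h2⟩
  have := two_mul_choose_sub_one q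
  omega

end IdentityGraftSharp

end Summit.ValiantsHypothesis.ValiantsHypothesis.Theorems.KPlusLogSqLaw.TowerGraft
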